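import Summits.CriticalPhenomena.PercolationContinuityZ3.Theorems.Transplant.FKConnectivityAllQThreePoint
import Summits.CriticalPhenomena.PercolationContinuityZ3.Theorems.Transplant.FKConnectivityAllQAdjacent
import HarnessLib

/-!
# Connectivity correlation inequalities for `φ_{w,q}`, every `q > 0` — the HUB COVARIANCE BOUND
# `(1 − q)·Cov(1{x ↔ y}, 1{x ↔ z}) ≤ φ(x ↮ y ↔ z)`: statement, conjecture node, and its EQUIVALENCE with negative correlation of
# adjacent edges

Support file (`--supports stmt-CriticalPhenomena-4575`), FK sub-lane `prim-bschramm-fk-3` (gen 7) of the post-continuity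
programme; builds on p205010 (kernel theorem, internal audit signed; external expert review pending).  No named facts, no sorries;
standard axioms.

THE STATEMENT.  For a finite measure `μ` on bond configurations, `q ∈ ℝ` and vertices `x, y, z`, the HUB COVARIANCE BOUND
`HubCovBoundUnder μ q x y z` is the homogeneous inequality
`(1 − q)·(μ(x ↔ y, x ↔ z)·μ(Ω) − μ(x ↔ y)·μ(x ↔ z)) ≤ μ(x ↮ y, y ↔ z)·μ(Ω)`;
for a probability measure: `(1 − q)·Cov(1{x ↔ y}, 1{x ↔ z}) ≤ μ(x ↮ y ↔ z)`, equivalently (gen 6, bschramm/FK-BARRIER.md §10.5)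
`μ(x ↔ y ↔ z)·(2 − q) ≤ μ(y ↔ z) + (1 − q)·μ(x ↔ y)·μ(x ↔ z)` — the three-point connection probability is at most the
`(1 : 1 − q)`-weighted mean of `μ(y ↔ z)` and `μ(x ↔ y)μ(x ↔ z)`.  In terms of the five partition-pattern masses of `{x, y, z}`
(`A = S(x|y|z)`, `Bxy = S(xy|z)`, `Bxz = S(xz|y)`, `Byz = S(x|yz)`, `C = S(xyz)`, `Z`) it is the THREE-POINT INEQUALITY
`(1 − q)(A·C − Bxy·Bxz) ≤ Byz·(Z − (1 − q)C)` of `…AllQThreePoint.lean` (`hubCovBoundUnder_iff_threePoint`).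

PROVED HERE (kernel; file 1 of 2 — the equivalence with negative correlation and its consequences are in `…AllQHubCovEquiv.lean`).
* the statement `HubCovBoundUnder μ q x y z`, the `q`-family `HubCovBoundFK q`, the conjecture node `HubCovBoundFKLtOne`
  (`∀ q ∈ (0,1)`, every finite weighted graph; `@[conjecture]`, NOT asserted); degenerate cases (`x = y`, `x = z`, `y = z`, `q = 1`);
* `hubCovBoundUnder_iff_threePoint` — measure form ⟺ mass form `0 ≤ Byz·(Z − (1−q)C) − (1−q)(A·C − Bxy·Bxz)`;
* `negCorr_adj_defect_eq_threePoint` — the EXACT identity behind gen 6's `negCorr_adj_of_threePoint`: for `e = xy`, `f = xz`,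
  `y ≠ z`, `q ≠ 0`, `U = w[e ↦ 0][f ↦ 0]`:
  `S_w(J_e ∩ J_f)·Z_w − S_w(J_e)·S_w(J_f) = −(w e)(1 − w e)(w f)(1 − w f)(q⁻¹ − 1)q⁻¹ · [Byz(Z − (1−q)C) − (1−q)(AC − Bxy·Bxz)]_U`,
  so that for `0 < q < 1` and `0 < w e, w f < 1` negative correlation of `J_e, J_f` is EQUIVALENT to the bound for `φ_U` (file 2).
EVIDENCE for the node (this seat, gen 7, bschramm/FK-BARRIER.md §11): exact/float census of the bound itself (set-partition transfer
matrix, pure rationals on every flagged cell) on random weighted graphs with `n ≤ 9` vertices, all `q`-regimes, adversarial local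
search, and the two `q ↓ 0` limits (uniform connected subgraphs: `W₁·W₃(x|y|z) ≤ W₁·W₂(x|yz) + (W₂(x|yz)+W₂(xz|y))(W₂(x|yz)+W₂(xy|z))`;
arboreal gas: `Cov_F(x ↔ y, x ↔ z) ≤ P_F(x ↮ y ↔ z)`) — 0 negatives; these limits are the ADJACENT-PAIR cases of Grimmett's
Conjecture (3.96) for UCS and USF, open in print.
[cite: Grimmett2006, §3.9 eq. (3.94), Conj. (3.96), Thm. (3.100) (pp. 63–66); Thm. (3.8) (q ≥ 1)] [cite: Wagner2006, Conj. 5.3, Conj. 5.4 (p. 13)]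
-/

noncomputable section

namespace Summit.CriticalPhenomena.PercolationContinuityZ3.Theorems

namespace FK

open MeasureTheory Set Literature.Probability.LatticeModels Literature.Probability.Percolation
open Literature.Probability.Percolation.DecisionTree (ind ind_of_mem ind_of_not_mem ind_nonneg)
open scoped Classical symmDiff

variable {V : Type*} [Fintype V]

/-! ### The statement and the conjecture node -/

/-- **Hub covariance bound under `μ`** at the hub `x` and the pair `y, z` (homogeneous form):
`(1 − q)·(μ(x ↔ y, x ↔ z)·μ(Ω) − μ(x ↔ y)·μ(x ↔ z)) ≤ μ(x ↮ y, y ↔ z)·μ(Ω)`.  For `μ = φ_{w,q}` with `w(xy) = w(xz) = 0` and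
`0 < q < 1` it is EQUIVALENT to negative correlation of the adjacent pairs `xy, xz` under `φ_{w[xy ↦ a][xz ↦ b],q}`, any
`0 < a, b < 1` (`negCorr_adj_iff_hubCovBound`). [cite: Grimmett2006, §3.9 eq. (3.94) (p. 63)] [cite: Wagner2006, Conj. 5.3 (p. 13)] -/
def HubCovBoundUnder (μ : Measure (BondConfig V)) (q : ℝ) (x y z : V) : Prop :=
  (1 - q) * (μ.real (openConn x y ∩ openConn x z) * μ.real univ - μ.real (openConn x y) * μ.real (openConn x z)) ≤
    μ.real ((openConn x y : Set (BondConfig V))ᶜ ∩ openConn y z) * μ.real univ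

/-- **Hub covariance bound for `φ_{w,q}` on every finite weighted graph** (vertex types `Fin n`), all hubs and pairs.
[cite: Grimmett2006, §3.9 eq. (3.94) (p. 63)] -/
def HubCovBoundFK (q : ℝ) : Prop :=
  ∀ (n : ℕ) (w : Sym2 (Fin n) → unitInterval) (x y z : Fin n), HubCovBoundUnder (rcMeasureW w q ∅) q x y z

/-- **Hub covariance bound for every `0 < q < 1`** — `(1 − q)·Cov_φ(1{x ↔ y}, 1{x ↔ z}) ≤ φ(x ↮ y ↔ z)` for every finite weighted
graph.  CONJECTURE-SHAPED STATEMENT, NOT asserted.  It implies negative correlation of adjacent edges for every `q < 1`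
(`edgeNegCorrAdjFKLtOne_of_hubCovBoundFKLtOne`), the random-cluster form of Wagner's Conjecture 5.3 and the adjacent-pair slice of
Grimmett's open problem §3.9 / Conjecture (3.96); it holds for `q ≥ 1` (`hubCovBoundFK_of_one_le`).  Evidence: bschramm/FK-BARRIER.md
§10.3–§10.5 (gen 6: coefficientwise), §11 (gen 7: value census `n ≤ 9`, `q ↓ 0` limits). [cite: Grimmett2006, §3.9, Conj. (3.96) (pp. 63–66)]
[cite: Wagner2006, Conj. 5.3, Conj. 5.4 (p. 13)] -/
@[conjecture] def HubCovBoundFKLtOne : Prop := ∀ q : ℝ, 0 < q → q < 1 → HubCovBoundFK q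

/-! ### Degenerate cases -/

omit [Fintype V] in
/-- The bound is trivial when the hub coincides with `y`. [folklore] -/
theorem hubCovBoundUnder_of_eq_left (μ : Measure (BondConfig V)) [IsFiniteMeasure μ] (q : ℝ) (x z : V) :
    HubCovBoundUnder μ q x x z := by
  unfold HubCovBoundUnder
  have huniv : (openConn x x : Set (BondConfig V)) = Set.univ :=
    Set.eq_univ_of_forall fun ω => (mem_openConn_iff' x x ω).2 (SimpleGraph.Reachable.refl x)
  rw [huniv, Set.univ_inter, Set.compl_univ, Set.empty_inter, measureReal_empty, zero_mul, mul_comm (μ.real univ), sub_self,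
    mul_zero]

omit [Fintype V] in
/-- The bound is trivial when the hub coincides with `z`. [folklore] -/
theorem hubCovBoundUnder_of_eq_right (μ : Measure (BondConfig V)) [IsFiniteMeasure μ] (q : ℝ) (x y : V) :
    HubCovBoundUnder μ q x y x := by
  unfold HubCovBoundUnder
  have huniv : (openConn x x : Set (BondConfig V)) = Set.univ :=
    Set.eq_univ_of_forall fun ω => (mem_openConn_iff' x x ω).2 (SimpleGraph.Reachable.refl x)
  rw [huniv, Set.inter_univ, sub_self, mul_zero]
  exact mul_nonneg measureReal_nonneg measureReal_nonneg

/-- The bound for `y = z` and `0 ≤ q`, probability measures: `(1 − q)·p(1 − p) ≤ 1 − p`. [folklore] -/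
theorem hubCovBoundUnder_of_eq (μ : Measure (BondConfig V)) [IsProbabilityMeasure μ] {q : ℝ} (hq : 0 ≤ q) (x y : V) :
    HubCovBoundUnder μ q x y y := by
  unfold HubCovBoundUnder
  rw [Set.inter_self, probReal_univ, mul_one, mul_one]
  have huniv : (openConn y y : Set (BondConfig V)) = Set.univ :=
    Set.eq_univ_of_forall fun ω => (mem_openConn_iff' y y ω).2 (SimpleGraph.Reachable.refl y)
  rw [huniv, Set.inter_univ, probReal_compl_eq_one_sub (measurableSet_openConn_holds x y)]
  have h0 : 0 ≤ μ.real (openConn x y) := measureReal_nonneg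
  have h1 : μ.real (openConn x y) ≤ 1 := measureReal_le_one
  nlinarith [mul_nonneg h0 (sub_nonneg.2 h1), mul_nonneg hq (mul_nonneg h0 (sub_nonneg.2 h1))]

omit [Fintype V] in
/-- The bound is trivial at `q = 1`. [folklore] -/
theorem hubCovBoundUnder_of_q_one (μ : Measure (BondConfig V)) (x y z : V) : HubCovBoundUnder μ 1 x y z := by
  unfold HubCovBoundUnder
  rw [sub_self, zero_mul]
  exact mul_nonneg measureReal_nonneg measureReal_nonneg

/-! ### Pattern masses: bookkeeping -/

/-- `S(x ↔ y) = S(xy|z) + S(xyz)` (as `S(Exy ∩ Exzᶜ) + S(Exy ∩ Exz)`). [folklore] -/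
theorem mass_openConn_split (U : Sym2 V → unitInterval) (q : ℝ) (x y z : V) :
    ∑ ω : BondConfig V, rcWeightW U q ∅ ω * ind (openConn x y : Set (BondConfig V)) ω =
      ∑ ω : BondConfig V, rcWeightW U q ∅ ω * ind (openConn x y ∩ openConn x z) ω +
        ∑ ω : BondConfig V, rcWeightW U q ∅ ω * ind (openConn x y ∩ (openConn x z : Set (BondConfig V))ᶜ) ω :=
  sum_rcWeightW_ind_split U q _ _

/-- `S(x ↮ y, x ↮ z) = S(x|yz) + S(x|y|z)`. [folklore] -/
theorem mass_sees_neither_split (U : Sym2 V → unitInterval) (q : ℝ) (x y z : V) :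
    ∑ ω : BondConfig V, rcWeightW U q ∅ ω * ind ((openConn x y : Set (BondConfig V))ᶜ ∩ (openConn x z : Set (BondConfig V))ᶜ) ω =
      ∑ ω : BondConfig V, rcWeightW U q ∅ ω * ind ((openConn x y : Set (BondConfig V))ᶜ ∩ openConn y z) ω +
        ∑ ω : BondConfig V, rcWeightW U q ∅ ω *
          ind ((openConn x y : Set (BondConfig V))ᶜ ∩ (openConn x z : Set (BondConfig V))ᶜ ∩ (openConn y z : Set (BondConfig V))ᶜ) ω := by
  rw [sum_rcWeightW_ind_split U q ((openConn x y : Set (BondConfig V))ᶜ ∩ (openConn x z : Set (BondConfig V))ᶜ) (openConn y z)]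
  congr 1
  refine sum_rcWeightW_ind_congr_set U q (Set.ext fun ω => ?_)
  simp only [Set.mem_inter_iff, Set.mem_compl_iff]
  constructor
  · rintro ⟨⟨h1, -⟩, h3⟩; exact ⟨h1, h3⟩
  · rintro ⟨h1, h3⟩
    refine ⟨⟨h1, fun h => h1 ?_⟩, h3⟩
    exact SimpleGraph.Reachable.trans (h : (openGraph ω).Reachable x z)
      (SimpleGraph.Reachable.symm (h3 : (openGraph ω).Reachable y z))

/-- `Z = C + Bxy + Bxz + Byz + A`. [folklore] -/
theorem partition_eq_pattern_masses (U : Sym2 V → unitInterval) (q : ℝ) (x y z : V) :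
    rcPartitionFunctionW U q ∅ =
      ∑ ω : BondConfig V, rcWeightW U q ∅ ω * ind (openConn x y ∩ openConn x z) ω +
      ∑ ω : BondConfig V, rcWeightW U q ∅ ω * ind (openConn x y ∩ (openConn x z : Set (BondConfig V))ᶜ) ω +
      ∑ ω : BondConfig V, rcWeightW U q ∅ ω * ind ((openConn x y : Set (BondConfig V))ᶜ ∩ openConn x z) ω +
      ∑ ω : BondConfig V, rcWeightW U q ∅ ω * ind ((openConn x y : Set (BondConfig V))ᶜ ∩ openConn y z) ω +
      ∑ ω : BondConfig V, rcWeightW U q ∅ ω *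
          ind ((openConn x y : Set (BondConfig V))ᶜ ∩ (openConn x z : Set (BondConfig V))ᶜ ∩ (openConn y z : Set (BondConfig V))ᶜ) ω := by
  have h1 := sum_rcWeightW_ind_compl U q (openConn x y : Set (BondConfig V))
  rw [mass_openConn_split U q x y z, sum_rcWeightW_ind_split U q (openConn x y : Set (BondConfig V))ᶜ (openConn x z),
    mass_sees_neither_split U q x y z] at h1
  linarith

/-! ### The hub covariance bound for `φ_U` in mass form -/

/-- **Measure form ⟺ mass form.**  For `0 < q`, the hub covariance bound for `φ_U` at `(x; y, z)` holds iff
`0 ≤ Byz·(Z − (1−q)C) − (1−q)(A·C − Bxy·Bxz)` for the pattern masses of `U`. [cite: Grimmett2006, §1.4 eq. (1.20) (p. 15); §3.9 (p. 63)] -/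
theorem hubCovBoundUnder_iff_threePoint {q : ℝ} (hq0 : 0 < q) (U : Sym2 V → unitInterval) (x y z : V) :
    HubCovBoundUnder (rcMeasureW U q ∅) q x y z ↔
      0 ≤ (∑ ω : BondConfig V, rcWeightW U q ∅ ω * ind ((openConn x y : Set (BondConfig V))ᶜ ∩ openConn y z) ω) *
            (rcPartitionFunctionW U q ∅ -
              (1 - q) * ∑ ω : BondConfig V, rcWeightW U q ∅ ω * ind (openConn x y ∩ openConn x z) ω) -
          (1 - q) *
            ((∑ ω : BondConfig V, rcWeightW U q ∅ ω *
                ind ((openConn x y : Set (BondConfig V))ᶜ ∩ (openConn x z : Set (BondConfig V))ᶜ ∩ (openConn y z : Set (BondConfig V))ᶜ) ω) *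
              (∑ ω : BondConfig V, rcWeightW U q ∅ ω * ind (openConn x y ∩ openConn x z) ω) -
             (∑ ω : BondConfig V, rcWeightW U q ∅ ω * ind (openConn x y ∩ (openConn x z : Set (BondConfig V))ᶜ) ω) *
              (∑ ω : BondConfig V, rcWeightW U q ∅ ω * ind ((openConn x y : Set (BondConfig V))ᶜ ∩ openConn x z) ω)) := by
  set A := ∑ ω : BondConfig V, rcWeightW U q ∅ ω *
    ind ((openConn x y : Set (BondConfig V))ᶜ ∩ (openConn x z : Set (BondConfig V))ᶜ ∩ (openConn y z : Set (BondConfig V))ᶜ) ω with hA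
  set Bxy := ∑ ω : BondConfig V, rcWeightW U q ∅ ω * ind (openConn x y ∩ (openConn x z : Set (BondConfig V))ᶜ) ω with hBxy
  set Bxz := ∑ ω : BondConfig V, rcWeightW U q ∅ ω * ind ((openConn x y : Set (BondConfig V))ᶜ ∩ openConn x z) ω with hBxz
  set Byz := ∑ ω : BondConfig V, rcWeightW U q ∅ ω * ind ((openConn x y : Set (BondConfig V))ᶜ ∩ openConn y z) ω with hByz
  set C := ∑ ω : BondConfig V, rcWeightW U q ∅ ω * ind (openConn x y ∩ openConn x z) ω with hC
  set Z := rcPartitionFunctionW U q ∅ with hZ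
  have hZpos : 0 < Z := rcPartitionFunctionW_pos U hq0 (∅ : Set V)
  haveI := isProbabilityMeasure_rcMeasureW U hq0 (∅ : Set V)
  have hZsum : Z = C + Bxy + Bxz + Byz + A := partition_eq_pattern_masses U q x y z
  have hxy : (rcMeasureW U q ∅).real (openConn x y) = (C + Bxy) / Z := by
    rw [rcMeasureW_real_eq_sum_div U hq0 ∅, mass_openConn_split U q x y z]
  have hxz : (rcMeasureW U q ∅).real (openConn x z) = (C + Bxz) / Z := by
    rw [rcMeasureW_real_eq_sum_div U hq0 ∅, mass_openConn_split U q x z y, hC, hBxz, Set.inter_comm (openConn x z) (openConn x y),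
      Set.inter_comm (openConn x z) (openConn x y : Set (BondConfig V))ᶜ]
  have hC' : (rcMeasureW U q ∅).real (openConn x y ∩ openConn x z) = C / Z := by
    rw [rcMeasureW_real_eq_sum_div U hq0 ∅]
  have hByz' : (rcMeasureW U q ∅).real ((openConn x y : Set (BondConfig V))ᶜ ∩ openConn y z) = Byz / Z := by
    rw [rcMeasureW_real_eq_sum_div U hq0 ∅]
  unfold HubCovBoundUnder
  rw [probReal_univ, mul_one, mul_one, hxy, hxz, hC', hByz']
  rw [show (1 - q) * (C / Z - (C + Bxy) / Z * ((C + Bxz) / Z)) = ((1 - q) * (C * Z - (C + Bxy) * (C + Bxz))) / (Z * Z) by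
    field_simp]
  rw [show Byz / Z = (Byz * Z) / (Z * Z) by field_simp, div_le_div_iff_of_pos_right (mul_pos hZpos hZpos)]
  constructor
  · intro h
    have : (1 - q) * (C * Z - (C + Bxy) * (C + Bxz)) = (1 - q) * (Byz * C + (A * C - Bxy * Bxz)) := by rw [hZsum]; ring
    nlinarith [h, this]
  · intro h
    have : (1 - q) * (C * Z - (C + Bxy) * (C + Bxz)) = (1 - q) * (Byz * C + (A * C - Bxy * Bxz)) := by rw [hZsum]; ring
    nlinarith [h, this]

/-! ### The exact identity behind adjacent-edge negative correlation -/

/-- **The adjacent-pair defect identity.**  For `e = xy`, `f = xz` with `y ≠ z`, `q ≠ 0` and `U = w[e ↦ 0][f ↦ 0]`: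
`S_w(J_e ∩ J_f)·Z_w − S_w(J_e)·S_w(J_f) = −((w e)(1 − w e)·((w f)(1 − w f))·(q⁻¹ − 1)·q⁻¹)·[Byz(Z − (1−q)C) − (1−q)(AC − Bxy·Bxz)]_U`
(the master identity `negCorr_defect_eq` + the toggle identity at `f` for the `f`-insensitive event "`y` is joined to neither `x` nor `z`
off `f`"; gen 6 proved the resulting implication, this is the equation). [cite: Grimmett2006, Thm. (3.1)(a) (p. 37); §3.9 eq. (3.94) (p. 63)] -/
theorem negCorr_adj_defect_eq_threePoint (w : Sym2 V → unitInterval) {q : ℝ} (hq : q ≠ 0) (x y z : V) (hyz : y ≠ z) :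
    (∑ ω : BondConfig V, rcWeightW w q ∅ ω * ind ({ω | s(x, y) ∈ ω} ∩ {ω | s(x, z) ∈ ω}) ω) * rcPartitionFunctionW w q ∅ -
        (∑ ω : BondConfig V, rcWeightW w q ∅ ω * ind {ω | s(x, y) ∈ ω} ω) *
          (∑ ω : BondConfig V, rcWeightW w q ∅ ω * ind {ω | s(x, z) ∈ ω} ω) =
      -((w s(x, y) : ℝ) * (1 - (w s(x, y) : ℝ)) * ((w s(x, z) : ℝ) * (1 - (w s(x, z) : ℝ))) * (q⁻¹ - 1) * q⁻¹ *
        ((∑ ω : BondConfig V, rcWeightW (Function.update (Function.update w s(x, y) 0) s(x, z) 0) q ∅ ω *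
              ind ((openConn x y : Set (BondConfig V))ᶜ ∩ openConn y z) ω) *
            (rcPartitionFunctionW (Function.update (Function.update w s(x, y) 0) s(x, z) 0) q ∅ -
              (1 - q) * ∑ ω : BondConfig V, rcWeightW (Function.update (Function.update w s(x, y) 0) s(x, z) 0) q ∅ ω *
                ind (openConn x y ∩ openConn x z) ω) -
          (1 - q) *
            ((∑ ω : BondConfig V, rcWeightW (Function.update (Function.update w s(x, y) 0) s(x, z) 0) q ∅ ω *
                ind ((openConn x y : Set (BondConfig V))ᶜ ∩ (openConn x z : Set (BondConfig V))ᶜ ∩ (openConn y z : Set (BondConfig V))ᶜ) ω) *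
              (∑ ω : BondConfig V, rcWeightW (Function.update (Function.update w s(x, y) 0) s(x, z) 0) q ∅ ω *
                ind (openConn x y ∩ openConn x z) ω) -
             (∑ ω : BondConfig V, rcWeightW (Function.update (Function.update w s(x, y) 0) s(x, z) 0) q ∅ ω *
                ind (openConn x y ∩ (openConn x z : Set (BondConfig V))ᶜ) ω) *
              (∑ ω : BondConfig V, rcWeightW (Function.update (Function.update w s(x, y) 0) s(x, z) 0) q ∅ ω *
                ind ((openConn x y : Set (BondConfig V))ᶜ ∩ openConn x z) ω)))) := by
  have hfe : s(x, z) ≠ s(x, y) := by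
    intro h
    rw [Sym2.eq_iff] at h
    rcases h with ⟨-, h⟩ | ⟨h1, h2⟩
    · exact hyz h.symm
    · exact hyz (h2.trans h1).symm
  -- names (as in `negCorr_adj_of_threePoint`)
  set U : Sym2 V → unitInterval := Function.update (Function.update w s(x, y) 0) s(x, z) 0 with hU
  set U1 : Sym2 V → unitInterval := Function.update (Function.update w s(x, y) 0) s(x, z) 1 with hU1
  set Exy : Set (BondConfig V) := openConn x y
  set Exz : Set (BondConfig V) := openConn x z
  set Eyz : Set (BondConfig V) := openConn y z
  set A := ∑ ω : BondConfig V, rcWeightW U q ∅ ω * ind (Exyᶜ ∩ Exzᶜ ∩ Eyzᶜ) ω with hA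
  set Bxy := ∑ ω : BondConfig V, rcWeightW U q ∅ ω * ind (Exy ∩ Exzᶜ) ω with hBxy
  set Bxz := ∑ ω : BondConfig V, rcWeightW U q ∅ ω * ind (Exyᶜ ∩ Exz) ω with hBxz
  set Byz := ∑ ω : BondConfig V, rcWeightW U q ∅ ω * ind (Exyᶜ ∩ Eyz) ω with hByz
  set C := ∑ ω : BondConfig V, rcWeightW U q ∅ ω * ind (Exy ∩ Exz) ω with hC
  set Z := rcPartitionFunctionW U q ∅ with hZ
  -- the `f`-insensitive event: `y` joined to neither `x` nor `z` off `f`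
  set F : Set (BondConfig V) := {ω | ¬ (openGraph (ω \ {s(x, z)})).Reachable x y ∧ ¬ (openGraph (ω \ {s(x, z)})).Reachable z y}
    with hF
  have hFins : ∀ ω : BondConfig V, ω ∆ {s(x, z)} ∈ F ↔ ω ∈ F := by
    intro ω
    have : (ω ∆ {s(x, z)}) \ {s(x, z)} = ω \ {s(x, z)} := by
      ext g
      simp only [Set.mem_sdiff, Set.mem_symmDiff, Set.mem_singleton_iff]
      tauto
    simp only [hF, Set.mem_setOf_eq, this]
  -- toggle identities at `f`
  have hZ1 : rcPartitionFunctionW U1 q ∅ = Z + (q⁻¹ - 1) * ∑ ω : BondConfig V, rcWeightW U q ∅ ω * ind Exzᶜ ω :=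
    rcPartitionFunctionW_update_one_eq_toggle (Function.update w s(x, y) 0) hq x z
  have hS1F : ∑ ω : BondConfig V, rcWeightW U1 q ∅ ω * ind F ω =
      ∑ ω : BondConfig V, rcWeightW U q ∅ ω * ind F ω +
        (q⁻¹ - 1) * ∑ ω : BondConfig V, rcWeightW U q ∅ ω * ind (F ∩ Exzᶜ) ω :=
    sum_rcWeightW_update_one_eq_toggle (Function.update w s(x, y) 0) hq x z F hFins
  -- under `U1` (`f` open a.s.), `{x ↮ y}` is `F`
  have hS1 : ∑ ω : BondConfig V, rcWeightW U1 q ∅ ω * ind Exyᶜ ω = ∑ ω : BondConfig V, rcWeightW U1 q ∅ ω * ind F ω := by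
    refine sum_rcWeightW_ind_congr_of_one U1 q (g := s(x, z)) (by simp [hU1]) fun ω hω => ?_
    rw [Set.mem_compl_iff, mem_openConn_iff', reachable_iff_off_pair hω, hF, Set.mem_setOf_eq, not_or]
  -- under `U` (`f` closed a.s.), `F` is `{x ↮ y} ∩ {z ↮ y}`
  have hdel : ∀ ω : BondConfig V, s(x, z) ∉ ω → ω \ {s(x, z)} = ω := fun ω hω =>
    Set.sdiff_singleton_eq_self hω
  have hS0F : ∑ ω : BondConfig V, rcWeightW U q ∅ ω * ind F ω = Bxz + A := by
    have h1 : ∑ ω : BondConfig V, rcWeightW U q ∅ ω * ind F ω =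
        ∑ ω : BondConfig V, rcWeightW U q ∅ ω * ind (Exyᶜ ∩ Eyzᶜ) ω := by
      refine sum_rcWeightW_ind_congr_of_zero U q (g := s(x, z)) (by simp [hU]) fun ω hω => ?_
      rw [hF, Set.mem_setOf_eq, hdel ω hω, Set.mem_inter_iff, Set.mem_compl_iff, Set.mem_compl_iff, mem_openConn_iff',
        mem_openConn_iff']
      exact ⟨fun ⟨h1, h2⟩ => ⟨h1, fun h => h2 h.symm⟩, fun ⟨h1, h2⟩ => ⟨h1, fun h => h2 h.symm⟩⟩
    rw [h1, sum_rcWeightW_ind_split U q (Exyᶜ ∩ Eyzᶜ) Exz, hBxz, hA]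
    congr 1
    · refine sum_rcWeightW_ind_congr_set U q (Set.ext fun ω => ?_)
      simp only [Set.mem_inter_iff, Set.mem_compl_iff]
      constructor
      · rintro ⟨⟨h1, -⟩, h3⟩
        exact ⟨h1, h3⟩
      · rintro ⟨h1, h3⟩
        refine ⟨⟨h1, fun h => h1 ?_⟩, h3⟩
        exact SimpleGraph.Reachable.trans (h3 : (openGraph ω).Reachable x z)
          (SimpleGraph.Reachable.symm (h : (openGraph ω).Reachable y z))
    · exact sum_rcWeightW_ind_congr_set U q (Set.inter_right_comm _ _ _)
  -- `S_U(F ∩ {x ↮ z}) = A`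
  have hS0Fxz : ∑ ω : BondConfig V, rcWeightW U q ∅ ω * ind (F ∩ Exzᶜ) ω = A := by
    rw [hA]
    refine sum_rcWeightW_ind_congr_of_zero U q (g := s(x, z)) (by simp [hU]) fun ω hω => ?_
    rw [Set.mem_inter_iff, hF, Set.mem_setOf_eq, hdel ω hω, Set.mem_inter_iff, Set.mem_inter_iff, Set.mem_compl_iff,
      Set.mem_compl_iff, Set.mem_compl_iff, mem_openConn_iff', mem_openConn_iff', mem_openConn_iff']
    constructor
    · rintro ⟨⟨h1, h2⟩, h3⟩; exact ⟨⟨h1, h3⟩, fun h => h2 h.symm⟩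
    · rintro ⟨⟨h1, h3⟩, h2⟩; exact ⟨⟨h1, fun h => h2 h.symm⟩, h3⟩
  -- `S_U(x ↮ y) = Bxz + (Byz + A)` and `S_U(x ↮ z) = Bxy + (Byz + A)`
  have hByzA : ∑ ω : BondConfig V, rcWeightW U q ∅ ω * ind (Exyᶜ ∩ Exzᶜ) ω = Byz + A := mass_sees_neither_split U q x y z
  have hS00 : ∑ ω : BondConfig V, rcWeightW U q ∅ ω * ind Exyᶜ ω = Bxz + (Byz + A) := by
    rw [sum_rcWeightW_ind_split U q Exyᶜ Exz, hBxz, hByzA]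
  have hSxz : ∑ ω : BondConfig V, rcWeightW U q ∅ ω * ind Exzᶜ ω = Bxy + (Byz + A) := by
    rw [sum_rcWeightW_ind_split U q Exzᶜ Exy, hBxy, ← hByzA, Set.inter_comm Exzᶜ Exy]
    congr 1
    exact sum_rcWeightW_ind_congr_set U q (Set.inter_comm _ _)
  -- `Z = C + Bxy + (Bxz + (Byz + A))`
  have hZsum : Z = C + Bxy + Bxz + Byz + A := partition_eq_pattern_masses U q x y z
  -- the pinned masses in terms of the pattern masses
  have hS01 : ∑ ω : BondConfig V, rcWeightW U1 q ∅ ω * ind Exyᶜ ω = (Bxz + A) + (q⁻¹ - 1) * A := by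
    rw [hS1, hS1F, hS0F, hS0Fxz]
  have hZ01 : rcPartitionFunctionW U1 q ∅ = Z + (q⁻¹ - 1) * (Bxy + (Byz + A)) := by rw [hZ1, hSxz]
  -- the master identity
  have hm := negCorr_defect_eq w hq x y hfe
  rw [← hU, ← hU1] at hm
  change (∑ ω : BondConfig V, rcWeightW w q ∅ ω * ind ({ω | s(x, y) ∈ ω} ∩ {ω | s(x, z) ∈ ω}) ω) * rcPartitionFunctionW w q ∅ -
      (∑ ω : BondConfig V, rcWeightW w q ∅ ω * ind {ω | s(x, y) ∈ ω} ω) *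
        (∑ ω : BondConfig V, rcWeightW w q ∅ ω * ind {ω | s(x, z) ∈ ω} ω) =
      (w s(x, y) : ℝ) * (1 - (w s(x, y) : ℝ)) * ((w s(x, z) : ℝ) * (1 - (w s(x, z) : ℝ))) * (q⁻¹ - 1) *
        ((∑ ω : BondConfig V, rcWeightW U1 q ∅ ω * ind Exyᶜ ω) * Z -
          (∑ ω : BondConfig V, rcWeightW U q ∅ ω * ind Exyᶜ ω) * rcPartitionFunctionW U1 q ∅) at hm
  rw [hS01, hZ01, hS00] at hm
  rw [hm]
  have key : ((Bxz + A) + (q⁻¹ - 1) * A) * Z - (Bxz + (Byz + A)) * (Z + (q⁻¹ - 1) * (Bxy + (Byz + A))) =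
      -(q⁻¹ * (Byz * (Z - (1 - q) * C) - (1 - q) * (A * C - Bxy * Bxz))) := by
    rw [hZsum]; field_simp; ring
  rw [key]; ring

end FK

end Summit.CriticalPhenomena.PercolationContinuityZ3.Theorems

end
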